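import Mathlib.GroupTheory.PushoutI
import Mathlib.GroupTheory.Coset.Basic
import Mathlib.GroupTheory.GroupAction.Quotient
import Mathlib.Combinatorics.Quiver.Basic
import Mathlib.Tactic.Group
import HarnessLib

/-!
# The Bass–Serre tree of an amalgamated free product `∗_H G_i` (data): vertices, edges, the action
# by left translation, stabilisers, and freeness of the action of a subgroup meeting the conjugates
# of the factors trivially

Topic `Literature/GroupTheory/CombinatorialGroupTheory`; DATA file (explicit `def`s, no `instance`
declarations, no notation) for the brick "finite amalgams are virtually free".  For Mathlib's amalgamated
free product `P = Monoid.PushoutI φ` (`φ i : H →* G i`, any index type `ι`) the graph of groups is a STAR —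
one central vertex group `H` joined by one edge to each factor `G i` — and its Bass–Serre tree `T`
(J.-P. Serre, *Trees*, Ch. I §4.1 Thm. 7 for two factors; §4.5 / §5.1 in general) has

* vertices (`Vertex φ`): the cosets `pH` (constructor `center`) and the cosets `p G_i` (`factor i`);
* edges (`Edge φ`): one edge `(i, pH)` from `center pH` (`Edge.src`) to `factor i (p G_i)` (`Edge.tgt`,
  well defined as `H ≤ G_i`);
* the action of `P` by left translation of cosets: `Vertex.smul`, `Edge.smul` (plain functions) with the
  action laws `Vertex.one_smul`/`Vertex.mul_smul`/`Edge.one_smul`/`Edge.mul_smul`, packaged as the explicit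
  (non-instance) `def`s `vertexAction`, `edgeAction : MulAction P _`, and the explicit quiver structure
  `treeQuiver φ : Quiver (Vertex φ)` (arrows `v ⟶ w` = edges with source `v` and target `w`); proof files
  may install these locally;
* equivariance `Edge.smul_src` / `Edge.smul_tgt`; stabilisers `smul_center_eq_iff` / `smul_factor_eq_iff`
  (`p` fixes `qH` iff `q⁻¹ p q ∈ H`, `p` fixes `q G_i` iff `q⁻¹ p q ∈ G_i`);
* **`smul_vertex_ne_self` / `smul_edge_ne_self`**: a subgroup `N ≤ P` meeting every conjugate of every
  factor trivially (`∀ p i g, p * of i g * p⁻¹ ∈ N → g = 1`) acts FREELY on vertices and edges — the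
  set-up of H. Neumann's theorem (Magnus–Karrass–Solitar Cor. 4.9.2) that such `N` is free, proved in the
  sequels by Serre's covering argument (I §3.3 Thm. 4).

## References
* J.-P. Serre, *Trees*, Springer (1980), Ch. I §3.3 Thm. 4, §4.1 Thm. 7, §5.1. [SerreTrees1980]
* W. Magnus, A. Karrass, D. Solitar, *Combinatorial Group Theory* (1966), §4.3, Cor. 4.9.2.
-/

namespace Literature.GroupTheory.CombinatorialGroupTheory

namespace PushoutITree

open Monoid Monoid.PushoutI Function

universe u v w

variable {ι : Type u} {G : ι → Type v} [∀ i, Group (G i)] {H : Type w} [Group H]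
  (φ : ∀ i, H →* G i)

/-- The image of the base group `H` in `P = ∗_H G_i` (the central vertex group of the star).
[cite: SerreTrees1980, I §4.1 Thm. 7] -/
abbrev baseRange : Subgroup (PushoutI φ) := (PushoutI.base φ).range

/-- The image of the factor `G i` in `P = ∗_H G_i` (a leaf vertex group of the star).
[cite: SerreTrees1980, I §4.1 Thm. 7] -/
abbrev ofRange (i : ι) : Subgroup (PushoutI φ) := (PushoutI.of (φ := φ) i).range

/-- `H ≤ G_i` inside `P`. [cite: SerreTrees1980, I §4.1 Thm. 7] -/
theorem baseRange_le_ofRange (i : ι) : baseRange φ ≤ ofRange φ i := by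
  rintro _ ⟨h, rfl⟩
  exact ⟨φ i h, by rw [of_apply_eq_base]⟩

/-- Vertices of the Bass–Serre tree of `∗_H G_i`: the cosets of `H` (central vertices of the subdivided
star) and the cosets of the factors `G i`. [cite: SerreTrees1980, I §4.1 Thm. 7] -/
inductive Vertex : Type (max u v w)
  /-- the vertex `pH` -/
  | center (c : PushoutI φ ⧸ baseRange φ) : Vertex
  /-- the vertex `p G_i` -/
  | factor (i : ι) (c : PushoutI φ ⧸ ofRange φ i) : Vertex

/-- Edges of the Bass–Serre tree: one edge `(i, pH)` for each index `i` and each coset `pH`, from the central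
vertex `pH` to the factor vertex `p G_i`. [cite: SerreTrees1980, I §4.1 Thm. 7] -/
structure Edge : Type (max u v w) where
  /-- the factor the edge points to -/
  idx : ι
  /-- the central vertex `pH` the edge starts from -/
  coset : PushoutI φ ⧸ baseRange φ

variable {φ}

/-- Source of the edge `(i, pH)`: the central vertex `pH`. [cite: SerreTrees1980, I §4.1 Thm. 7] -/
def Edge.src (e : Edge φ) : Vertex φ := Vertex.center e.coset

/-- Target of the edge `(i, pH)`: the factor vertex `p G_i` (well defined since `H ≤ G_i`).
[cite: SerreTrees1980, I §4.1 Thm. 7] -/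
def Edge.tgt (e : Edge φ) : Vertex φ :=
  Vertex.factor e.idx (Subgroup.quotientMapOfLE (baseRange_le_ofRange φ e.idx) e.coset)

/-- `src (i, c) = center c`. [cite: SerreTrees1980, I §4.1 Thm. 7] -/
@[simp] theorem Edge.src_mk (i : ι) (c : PushoutI φ ⧸ baseRange φ) :
    (Edge.mk i c).src = Vertex.center c := rfl

/-- `tgt (i, pH) = factor i (p G_i)`. [cite: SerreTrees1980, I §4.1 Thm. 7] -/
@[simp] theorem Edge.tgt_mk (i : ι) (p : PushoutI φ) :
    (Edge.mk i (QuotientGroup.mk p : PushoutI φ ⧸ baseRange φ)).tgt =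
      Vertex.factor i (QuotientGroup.mk p : PushoutI φ ⧸ ofRange φ i) := rfl

variable (φ) in
/-- The Bass–Serre tree as a quiver (explicit structure, to be installed locally by proof files): arrows
`v ⟶ w` are the edges with source `v` and target `w`. [cite: SerreTrees1980, I §4.1 Thm. 7] -/
@[reducible] def treeQuiver : Quiver (Vertex φ) := ⟨fun v w => {e : Edge φ // e.src = v ∧ e.tgt = w}⟩

/-- Two factor vertices with the same index are equal iff their cosets are.
[cite: SerreTrees1980, I §4.1 Thm. 7] -/
theorem factor_inj {i : ι} {c c' : PushoutI φ ⧸ ofRange φ i} :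
    (Vertex.factor i c : Vertex φ) = Vertex.factor i c' ↔ c = c' := by
  constructor
  · intro h
    obtain ⟨-, h2⟩ := Vertex.factor.inj h
    exact eq_of_heq h2
  · rintro rfl; rfl

/-! ### The action of `P` by left translation -/

/-- Left translation of a vertex by `p ∈ P`. [cite: SerreTrees1980, I §4.1 Thm. 7] -/
def Vertex.smul (p : PushoutI φ) : Vertex φ → Vertex φ
  | Vertex.center c => Vertex.center (p • c)
  | Vertex.factor i c => Vertex.factor i (p • c)

/-- `p · (center c) = center (p c)`. [cite: SerreTrees1980, I §4.1 Thm. 7] -/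
@[simp] theorem Vertex.smul_center (p : PushoutI φ) (c : PushoutI φ ⧸ baseRange φ) :
    Vertex.smul p (Vertex.center c) = Vertex.center (p • c) := rfl

/-- `p · (factor i c) = factor i (p c)`. [cite: SerreTrees1980, I §4.1 Thm. 7] -/
@[simp] theorem Vertex.smul_factor (p : PushoutI φ) (i : ι) (c : PushoutI φ ⧸ ofRange φ i) :
    Vertex.smul p (Vertex.factor i c) = Vertex.factor i (p • c) := rfl

/-- Action law `1 · v = v`. [cite: SerreTrees1980, I §4.1 Thm. 7] -/
theorem Vertex.one_smul (v : Vertex φ) : Vertex.smul 1 v = v := by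
  cases v with
  | center c => exact congrArg Vertex.center (_root_.one_smul _ c)
  | factor i c => exact congrArg (Vertex.factor i) (_root_.one_smul _ c)

/-- Action law `(p q) · v = p · (q · v)`. [cite: SerreTrees1980, I §4.1 Thm. 7] -/
theorem Vertex.mul_smul (p q : PushoutI φ) (v : Vertex φ) :
    Vertex.smul (p * q) v = Vertex.smul p (Vertex.smul q v) := by
  cases v with
  | center c => exact congrArg Vertex.center (SemigroupAction.mul_smul p q c)
  | factor i c => exact congrArg (Vertex.factor i) (SemigroupAction.mul_smul p q c)

variable (φ) in
/-- The action of `P` on the vertices as an explicit (non-instance) `MulAction` structure.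
[cite: SerreTrees1980, I §4.1 Thm. 7] -/
@[reducible] def vertexAction : MulAction (PushoutI φ) (Vertex φ) where
  smul := Vertex.smul
  one_smul := Vertex.one_smul
  mul_smul := Vertex.mul_smul

/-- Left translation of an edge by `p ∈ P`. [cite: SerreTrees1980, I §4.1 Thm. 7] -/
def Edge.smul (p : PushoutI φ) (e : Edge φ) : Edge φ := ⟨e.idx, p • e.coset⟩

/-- `(p · e).idx = e.idx`. [cite: SerreTrees1980, I §4.1 Thm. 7] -/
@[simp] theorem Edge.smul_idx (p : PushoutI φ) (e : Edge φ) : (Edge.smul p e).idx = e.idx := rfl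

/-- `(p · e).coset = p e.coset`. [cite: SerreTrees1980, I §4.1 Thm. 7] -/
@[simp] theorem Edge.smul_coset (p : PushoutI φ) (e : Edge φ) : (Edge.smul p e).coset = p • e.coset := rfl

/-- Action law `1 · e = e`. [cite: SerreTrees1980, I §4.1 Thm. 7] -/
theorem Edge.one_smul (e : Edge φ) : Edge.smul 1 e = e := by
  cases e with
  | mk i c => exact congrArg (Edge.mk i) (_root_.one_smul _ c)

/-- Action law `(p q) · e = p · (q · e)`. [cite: SerreTrees1980, I §4.1 Thm. 7] -/
theorem Edge.mul_smul (p q : PushoutI φ) (e : Edge φ) :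
    Edge.smul (p * q) e = Edge.smul p (Edge.smul q e) := by
  cases e with
  | mk i c => exact congrArg (Edge.mk i) (SemigroupAction.mul_smul p q c)

variable (φ) in
/-- The action of `P` on the edges as an explicit (non-instance) `MulAction` structure.
[cite: SerreTrees1980, I §4.1 Thm. 7] -/
@[reducible] def edgeAction : MulAction (PushoutI φ) (Edge φ) where
  smul := Edge.smul
  one_smul := Edge.one_smul
  mul_smul := Edge.mul_smul

/-- The action commutes with `src`. [cite: SerreTrees1980, I §4.1 Thm. 7] -/
theorem Edge.smul_src (p : PushoutI φ) (e : Edge φ) : (Edge.smul p e).src = Vertex.smul p e.src := rfl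

/-- The action commutes with `tgt`. [cite: SerreTrees1980, I §4.1 Thm. 7] -/
theorem Edge.smul_tgt (p : PushoutI φ) (e : Edge φ) : (Edge.smul p e).tgt = Vertex.smul p e.tgt := by
  obtain ⟨i, c⟩ := e
  induction c using QuotientGroup.induction_on with
  | H q => rfl

/-! ### Stabilisers: fixing a vertex means lying in the corresponding conjugate subgroup -/

/-- `p` fixes the central vertex `qH` iff `q⁻¹ p q ∈ H`. [cite: SerreTrees1980, I §4.1 Thm. 7] -/
theorem smul_center_eq_iff (p q : PushoutI φ) :
    Vertex.smul p (Vertex.center (QuotientGroup.mk q)) = Vertex.center (QuotientGroup.mk q) ↔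
      q⁻¹ * p * q ∈ baseRange φ := by
  rw [Vertex.smul_center, Vertex.center.injEq, MulAction.Quotient.smul_mk, QuotientGroup.eq, smul_eq_mul]
  constructor <;> intro h
  · simpa [mul_assoc] using Subgroup.inv_mem _ h
  · have := Subgroup.inv_mem _ h
    simpa [mul_assoc] using this

/-- `p` fixes the factor vertex `q G_i` iff `q⁻¹ p q ∈ G_i`. [cite: SerreTrees1980, I §4.1 Thm. 7] -/
theorem smul_factor_eq_iff (p q : PushoutI φ) (i : ι) :
    Vertex.smul p (Vertex.factor i (QuotientGroup.mk q)) = Vertex.factor i (QuotientGroup.mk q) ↔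
      q⁻¹ * p * q ∈ ofRange φ i := by
  rw [Vertex.smul_factor, factor_inj, MulAction.Quotient.smul_mk, QuotientGroup.eq, smul_eq_mul]
  constructor <;> intro h
  · simpa [mul_assoc] using Subgroup.inv_mem _ h
  · have := Subgroup.inv_mem _ h
    simpa [mul_assoc] using this

/-! ### Freeness of the action of a subgroup meeting the conjugates of the factors trivially -/

/-- A subgroup meeting every conjugate of every factor `G i` trivially also meets every conjugate of the
base group `H` trivially (as `H ≤ G i` for any `i`). [cite: SerreTrees1980, I §4.1 Thm. 7] -/
theorem inf_conj_base_of_inf_conj_factor [Nonempty ι] {N : Subgroup (PushoutI φ)}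
    (hN : ∀ (p : PushoutI φ) (i : ι) (g : G i), p * of i g * p⁻¹ ∈ N → g = 1)
    (hφ : ∀ i, Injective (φ i)) (p : PushoutI φ) (h : H) (hh : p * PushoutI.base φ h * p⁻¹ ∈ N) :
    h = 1 := by
  obtain ⟨i⟩ := ‹Nonempty ι›
  have := hN p i (φ i h) (by rwa [of_apply_eq_base])
  exact hφ i (by rw [this, map_one])

/-- **Freeness on vertices** (the hypothesis of Serre I §3.3 Thm. 4 for H. Neumann's subgroups): if
`N ≤ ∗_H G_i` meets every conjugate of every factor trivially, then a non-trivial element of `N` fixes no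
vertex of the Bass–Serre tree. [cite: SerreTrees1980, I §3.3 Thm. 4] -/
theorem smul_vertex_ne_self [Nonempty ι] {N : Subgroup (PushoutI φ)} (hφ : ∀ i, Injective (φ i))
    (hN : ∀ (p : PushoutI φ) (i : ι) (g : G i), p * of i g * p⁻¹ ∈ N → g = 1)
    {n : PushoutI φ} (hn : n ∈ N) (hn1 : n ≠ 1) (v : Vertex φ) : Vertex.smul n v ≠ v := by
  intro hv
  cases v with
  | center c =>
    induction c using QuotientGroup.induction_on with
    | H q =>
      obtain ⟨h, hh⟩ := (smul_center_eq_iff n q).mp hv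
      have hmem : q * PushoutI.base φ h * q⁻¹ ∈ N := by
        rw [hh]; simpa [mul_assoc] using hn
      have := inf_conj_base_of_inf_conj_factor hN hφ q h hmem
      apply hn1
      have hq : q⁻¹ * n * q = 1 := by rw [← hh, this, map_one]
      have : n = q * (q⁻¹ * n * q) * q⁻¹ := by group
      rw [this, hq]; group
  | factor i c =>
    induction c using QuotientGroup.induction_on with
    | H q =>
      obtain ⟨g, hg⟩ := (smul_factor_eq_iff n q i).mp hv
      have hmem : q * of i g * q⁻¹ ∈ N := by
        rw [hg]; simpa [mul_assoc] using hn
      have := hN q i g hmem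
      apply hn1
      have hq : q⁻¹ * n * q = 1 := by rw [← hg, this, map_one]
      have : n = q * (q⁻¹ * n * q) * q⁻¹ := by group
      rw [this, hq]; group

/-- **Freeness on edges**: no non-trivial element of such an `N` fixes an edge (so there are no edge
inversions to worry about either, the tree being bipartite). [cite: SerreTrees1980, I §3.3 Thm. 4] -/
theorem smul_edge_ne_self [Nonempty ι] {N : Subgroup (PushoutI φ)} (hφ : ∀ i, Injective (φ i))
    (hN : ∀ (p : PushoutI φ) (i : ι) (g : G i), p * of i g * p⁻¹ ∈ N → g = 1)
    {n : PushoutI φ} (hn : n ∈ N) (hn1 : n ≠ 1) (e : Edge φ) : Edge.smul n e ≠ e := by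
  intro he
  have := congrArg Edge.src he
  rw [Edge.smul_src] at this
  exact smul_vertex_ne_self hφ hN hn hn1 e.src this

end PushoutITree

end Literature.GroupTheory.CombinatorialGroupTheory
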